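import Mathlib
import Literature.RingTheory.CentralSimple.AlbertTypes
import HarnessLib

/-!
# Kottwitz 1992, §7 «Structure of the groups `G` and `G₁`» — statements as printed (carpet, no proofs)

[Kottwitz1992] R. E. Kottwitz, *Points on some Shimura varieties over finite fields*, J. Amer. Math.
Soc. **5** (1992) 373–444, §7, pp. 393–398.  SOURCE READ: the held text `paper:doi-10-2307-2152772`
(pdf page `p00NN` = printed page `372 + NN`; §7 = p0021 L26 – p0026 L25).  Squad TK (HCML «GO 500»,
seat TK-t03), target `Literature/NumberTheory/Kottwitz1992/GroupStructure.lean`.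

Every numbered statement of §7 — **Lemma 7.1** (p. 395), **Lemma 7.2** (p. 395), **Corollary 7.3**
(p. 396), **Lemma 7.4** (p. 397), **Remark 7.5** (p. 398) — and the load-bearing unnumbered
Hasse-principle paragraph (pp. 393–394) are typed as NAMED-FACT PREDICATES `def Kottwitz1992_7_… : Prop`
over Mathlib notions.  Nothing is proved and nothing is asserted: each `def` is a predicate on the data
it binds (Kottwitz's data of §5, presented as below); `∀ data, P data` is NOT claimed.

## The standing data (§5 p. 389, «We retain the notation of §5», p. 393) and how it is presented

§5 (p0017 L15–L31): `B` a finite-dimensional simple `ℚ`-algebra with centre `F`, `*` a positive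
involution on `B`, `F₀` the fixed field of `*` on `F`; `V` a nonzero finitely generated left `B`-module
with a nondegenerate `ℚ`-valued alternating form `(·,·)` such that `(bv, w) = (v, b* w)`;
`C = End_B(V)` with the involution `*` coming from the form; `G(R) = {x ∈ C ⊗_ℚ R | x x* ∈ R^×}`,
`G₁(R) = {x ∈ C ⊗_ℚ R | x x* = 1}`; Cases A (involution of the second kind), C, D (first kind,
`G₀` symplectic resp. orthogonal over `F̄₀`), p. 390 (p0019 L31–L43).

Lean presentation (all carrier types in `Type`; ground field `k` = `ℚ`, or a `p`-adic field `L`,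
or an algebraically closed `K`):
* the involution is an explicit `k`-linear map `ι : B →ₗ[k] B` (the tree's unbundled convention of
  `Literature.RingTheory.CentralSimple.IsAntiInvolution` / `IsPositiveAntiInvolution`, which ARE
  reused for `k = ℚ`), the form is `φ : LinearMap.BilinForm k V`, «skew-Hermitian» is the identity
  `φ (b • v) w = φ v (ι b • w)`;
* `C ⊗_ℚ k` is `Module.End B_k V_k` (`= End_{B ⊗ k}(V ⊗ k)`, `V` being projective over the simple
  algebra `B`), so `H(k) = C_k^×` is `(Module.End B_k V_k)ˣ` and `G(k)` is the SET `similitudes φ_k`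
  of units `x` with `φ_k (x v) (x w) = c · φ_k v w` for some `c ∈ k^×` — this is Kottwitz's
  `c : G → 𝔾_m`, «the scalar `c(g) ∈ K^×` such that `(gv, gw) = c(v, w)`» (p. 395, p0023 L5–L6);
  for nondegenerate `φ_k` it is the printed `x x* ∈ k^×`;
* EXTENSION OF SCALARS from `ℚ` to a field `K ⊇ ℚ` is presented, not constructed: a `K`-datum
  `(B_K, ι_K, V_K, φ_K)` together with maps `jB : B →ₐ[ℚ] B_K`, `jV : V →ₗ[ℚ] V_K` satisfying Mathlib's
  `IsBaseChange K` and the obvious compatibilities (`IsAlgebraExtension`, `IsModuleExtension` below).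
  Such a presentation exists and is unique up to unique isomorphism, so quantifying over all
  presentations (as the local statements do) is quantifying over THE base change;
* the `p`-adic coefficient ring of Lemmas 7.2–7.4 is a pair `(O, L)`, `L = Frac O`, with
  `IsUnramifiedLocalRing p O` (complete discrete valuation ring of characteristic `0` with finite residue
  field of characteristic `p` and uniformizer `p`) — i.e. `L` is `ℚ_p` (`O = ℤ_[p]`) or a finite
  unramified extension of it, which is EXACTLY the generality granted by **Remark 7.5** (p. 398:
  «In Lemma 7.2, Corollary 7.3, and Lemma 7.4 the base field `ℚ_p` can be replaced by any unramified
  extension of `ℚ_p`.»); the §5/§7 hypotheses at `p` (p. 395, p0023 L27–L32: «the `ℚ_p`-algebra `F` is a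
  finite product of finite unramified extensions of `ℚ_p`, the algebra `B` is a matrix algebra over `F`,
  the order `𝒪_B` is a maximal order in `B` …, the involution `*` of `B` preserves `𝒪_B`, and there exists
  a self-dual `𝒪_B`-lattice `Λ` in `V`») are the fields of `IsPadicDatum`;
* Galois cohomology.  Mathlib has no `H¹(ℚ, G)` for a reductive group.  The Hasse-principle statements
  are therefore typed through the dictionary THE PAPER ITSELF uses in §8: «Isomorphism classes of
  skew-Hermitian `B`-modules of the same dimension as `V` are classified by `H¹(ℚ, G)`» (p. 399, p0027
  L31–L32), so `ker¹(ℚ, G)` trivial ⟺ every nondegenerate skew-Hermitian `B`-module `V' ≃_B V` that is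
  isomorphic to `V` over every `ℚ_v` is isomorphic to `V` over `ℚ` (READING R-H1); and
  «`H¹(ℚ, Z) = F₀^× / ℚ^× N_{F/F₀}(F^×)`» (p. 400, p0028 L23–L24) with the central class `a ∈ F₀^×` acting
  on forms by `(v, w) ↦ (a v, w)` (the automorphism `(A, λ, i, η̄) ↦ (A, λ∘i(a), i, βη̄)` of p. 400,
  p0028 L29–L31) (READING R-Z).  Both readings are flagged for the citation desk.

## NOT typed here (and why)
* «In Cases A and C the group `G` is connected and reductive, while in Case D it is reductive with
  `2^[F₀:ℚ]` connected components. Moreover in Cases A and C the derived group of `G` is simply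
  connected.» (p. 393, p0021 L30–L33) — structure theory of algebraic groups, no Lean vocabulary;
* «`ker¹(ℚ, G) = ker¹(ℚ, D)` (see Lemma 4.3.1 of [K2])» (p. 393) — a CITED row of [K2] = Kottwitz 1984,
  dealt to the squad's Kottwitz1983∕84 typer;
* the Case-D variant of Lemma 7.2 (extra hypotheses «`p ≠ 2` and … the element of `H¹(ℚ_p, G)` that
  measures the difference between `V` and `V'` is sent to the trivial element of `H¹(ℚ_p, G/G⁰)`»,
  p. 395): the second hypothesis has no form-theoretic dictionary in the paper; Lemma 7.2 is typed in
  Cases A and C (Case D is excluded from §14 on, p. 418).  `-- TODO(Case D of Lemma 7.2)`.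

## Dedup census (tree theorems already PROVING special cases; cited, not restated)
* Lemma 7.1, one factor of type C∕D and Case A: `Literature.LinearAlgebra.Matrix.IsometryConjugacy.
  exists_similitude_conj_iff`, `exists_isometry_conj_iff`, `symplecticGroup_exists_conj_iff`,
  `orthogonal_exists_conj_iff`, `isConj_prod_diag_iff` (file `LinearAlgebra/Matrix/IsometryConjugacyAlgClosed`);
  semisimple shortcut `…IsometryConjugacySemisimpleAlgClosed`, class version
  `…IsometryConjugacyClassesAlgClosed`; unitary similitudes `Literature.NumberTheory.Automorphic.
  UnitarySimilitude…` (`UnitarySimilitude.isConj_similitude_iff`, file `UnitarySimilitudeConjugacyAlgClosed`).  The reduction of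
  `G(K)` to its simple factors is NOT in the tree — the statement below is the printed general one.
* Lemma 7.2 ∕ Cor. 7.3 for one split factor (matrices over `ℤ_p`, alternating / Hermitian / symmetric):
  `LinearAlgebra/Matrix/HermitianFormsHenselLemma` (`exists_isometry_padicInt`, the `p`-adic Newton
  iteration of p. 396), `LinearAlgebra/Matrix/AlternatingCongruenceLocalRing` (`exists_conj_eq_padicInt`),
  `NumberTheory/QuadraticForms/SelfDualLatticesUpToScalar` (`exists_similitude_map_eq_padic`),
  `…SelfDualHermitianLatticesUpToScalar`, `…SelfDualLatticesIsometricPairs`,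
  `…SelfDualLatticesUpToScalarOrthogonal`, `NumberTheory/LocalFields/UnramifiedQuadraticNormSurjective`
  (Lang's-theorem step, Case A), `NumberTheory/Automorphic/UnitaryGroupSelfDualLocus…`,
  `…FixedCosetsStableLattices` (counting corollaries).
* Lemma 7.4, Case C (`GSp_{2n}`, Cartan decomposition and Weyl-chamber argument):
  `NumberTheory/Automorphic/SymplecticSimilitudeDoubleCosets` (`eq_of_similitudeTorusElt_mem_doubleCoset`,
  `bijective_heckeCosetMk_similitudeTorusElt`), `…SymplecticSimilitudeCartanUnique`,
  `…SymplecticGroupCartanDecomposition`, `GroupTheory/Coxeter/WeylOrbitsSymplecticInGeneralLinear`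
  (`exists_perm_forall_eq_or_eq_neg`, the p. 397 chamber argument), `NumberTheory/ModularForms/
  SiegelHeckeRingLocalPadic`.
* pp. 393–394 torus algebra: `NumberTheory/Automorphic/UnitarySimilitudeNormTorus`
  (`exists_mulEquiv_prod` — `D ≅ D₁ × 𝔾_m` for `n = 2k`; `exists_mulEquiv_of_injective` — `n = 2k+1`),
  `…UnitarySimilitudeDerivedQuotient`, `…UnitarySimilitudeCentralTorusDecomposition`,
  `…SymplecticSimilitudeMultiplier(Character)` («in Case C the torus `D` is isomorphic to `𝔾_m`»),
  `…OrthogonalSimilitudeProperCharacter`.  Nothing on `ker¹` is in the tree (census of the cited files'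
  own headers); the `ker¹` statements below are new.
-/

open Module

namespace Literature.NumberTheory.Kottwitz1992.GroupStructure

/-! ## 1. Skew-Hermitian modules, similitudes, cases A ∕ C ∕ D (points over a ground field `k`) -/

section GroundField

variable (k : Type) [Field k]
variable {B : Type} [Ring B] [Algebra k B] (ι : B →ₗ[k] B)
variable {V : Type} [AddCommGroup V] [Module k V] [Module B V] [IsScalarTower k B V]
variable (φ : LinearMap.BilinForm k V)

/-- «a nondegenerate skew-Hermitian `B`-module (a finitely generated left `B`-module together with a
nondegenerate `ℚ`-valued alternating form `(·,·)` such that `(bv, w) = (v, b*w)` for all `v, w ∈ V` and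
all `b ∈ B`)» — the three conditions on the form `φ`, the involution being `ι = *`.
[cite: Kottwitz1992, Introduction (p. 374) and §5 (p. 389)] -/
structure IsSkewHermitian : Prop where
  /-- `(·,·)` is alternating. -/
  isAlt : φ.IsAlt
  /-- `(·,·)` is nondegenerate. -/
  nondegenerate : φ.Nondegenerate
  /-- `(bv, w) = (v, b* w)`. -/
  skew : ∀ (b : B) (v w : V), φ (b • v) w = φ v (ι b • w)

/-- `G(k)`, the `k`-points of Kottwitz's group `G` of automorphisms of the skew-Hermitian `B`-module `V`:
units `x` of `C_k = End_B(V)` preserving the form up to an invertible scalar, `(xv, xw) = c (v, w)`,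
`c = c(x) ∈ k^×` («In fact `G` is a group of similitudes», p. 374; `G(R) = {x ∈ C ⊗_ℚ R | x x* ∈ R^×}`,
p. 389; `c : G → 𝔾_m`, p. 395).  A SET of units (no group structure is claimed here).
[cite: Kottwitz1992, §5 (p. 389) and §7 (p. 395)] -/
def similitudes (B : Type) [Ring B] [Algebra k B] [Module B V] [IsScalarTower k B V] :
    Set (Module.End B V)ˣ :=
  {x | ∃ c : kˣ, ∀ v w : V, φ ((x : Module.End B V) v) ((x : Module.End B V) w) = (c : k) * φ v w}

/-- `x` and `y` have the same multiplier, `c(x) = c(y)` (p. 395): some `c ∈ k` is a multiplier of both.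
[cite: Kottwitz1992, §7 (p. 395)] -/
def SameMultiplier (B : Type) [Ring B] [Algebra k B] [Module B V] [IsScalarTower k B V]
    (x y : (Module.End B V)ˣ) : Prop :=
  ∃ c : k, (∀ v w : V, φ ((x : Module.End B V) v) ((x : Module.End B V) w) = c * φ v w) ∧
    (∀ v w : V, φ ((y : Module.End B V) v) ((y : Module.End B V) w) = c * φ v w)

/-- The involution `*` is **of the first kind**: trivial on the centre `F` of `B`, i.e. `F = F₀`
(p. 390: «either `F = F₀`, in which case `*` is said to be of the first kind, or else `F` is a totally
complex quadratic extension of `F₀`, in which case `*` is said to be of the second kind»).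
[cite: Kottwitz1992, §5 (p. 390)] -/
def IsFirstKind : Prop :=
  ∀ z ∈ Subalgebra.center k B, ι z = z

/-- `S` is the `*`-symmetric part of `C_k = End_B(V)` for the adjoint involution of the form: the
`k`-subspace of `B`-linear `x` with `(xv, w) = (v, xw)`, i.e. `x* = x` («`C = End_B(V)` … has an
involution `*` coming from the form `(·,·)`», p. 389).  (A membership characterisation of the evident
subspace, so that no closure proof is needed here; used only to tell Case C from Case D by a dimension
count.) [cite: Kottwitz1992, §5 (p. 389)] -/
def IsSelfAdjointPart (B : Type) [Ring B] [Algebra k B] [Module B V] [IsScalarTower k B V]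
    (S : Submodule k (Module.End B V)) : Prop :=
  ∀ x : Module.End B V, x ∈ S ↔ ∀ v w : V, φ (x v) w = φ v (x w)

/-- **Case A**: `*` is of the second kind (`F ≠ F₀`; `G₀` an inner form of a quasi-split unitary group,
type `A_{n-1}`). [cite: Kottwitz1992, §5 (p. 390)] -/
def IsCaseA : Prop :=
  ¬ IsFirstKind k ι

/-- **Case C**: `*` of the first kind and `G₀` symplectic in `m = 2n` variables over `F̄₀`; equivalently
the adjoint involution on the central simple `F`-algebra `C` (`dim_F C = m²`, p. 390: «Let `m` be the
positive integer defined by `[F : F₀](dim_F C)^{1/2}`») is of symplectic type, i.e. its symmetric part has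
`F`-dimension `m(m-1)/2`; written over `k` with `d = [F : k] = dim_k Z(B)`:
`dim_k C = d m²` and `2 dim_k Sym(C) + d m = dim_k C` (`Sym(C)` = the subspace `S` of `IsSelfAdjointPart`). [cite: Kottwitz1992, §5 (p. 390)] -/
def IsCaseC : Prop :=
  IsFirstKind k ι ∧ ∃ S : Submodule k (Module.End B V), IsSelfAdjointPart k φ B S ∧ ∃ m : ℕ,
    finrank k (Subalgebra.center k B) * m ^ 2 = finrank k (Module.End B V) ∧
    2 * finrank k S + finrank k (Subalgebra.center k B) * m = finrank k (Module.End B V)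

/-- **Case D**: `*` of the first kind and `G₀` orthogonal in `2n` variables over `F̄₀`; equivalently the
adjoint involution on `C` is of orthogonal type, `dim_F Sym(C) = m(m+1)/2`:
`2 dim_k Sym(C) = dim_k C + d m`. [cite: Kottwitz1992, §5 (p. 390)] -/
def IsCaseD : Prop :=
  IsFirstKind k ι ∧ ∃ S : Submodule k (Module.End B V), IsSelfAdjointPart k φ B S ∧ ∃ m : ℕ,
    finrank k (Subalgebra.center k B) * m ^ 2 = finrank k (Module.End B V) ∧
    2 * finrank k S = finrank k (Module.End B V) + finrank k (Subalgebra.center k B) * m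

end GroundField

/-! ## 2. The rational datum of §5 and its extensions of scalars -/

section Rational

variable {B : Type} [Ring B] [Algebra ℚ B] (ι : B →ₗ[ℚ] B)
variable {V : Type} [AddCommGroup V] [Module ℚ V] [Module B V] [IsScalarTower ℚ B V]
variable (φ : LinearMap.BilinForm ℚ V)

/-- The part of the «long list of data» of §5 (p. 389) that §7 uses: `B` a finite-dimensional simple
`ℚ`-algebra, `*` = `ι` a positive involution (the tree's
`Literature.RingTheory.CentralSimple.IsPositiveAntiInvolution`, positivity of `tr(x x*)` over `ℚ`,
equivalent to Kottwitz's positivity over `ℝ`, §2 p. 379), `V` a nonzero finitely generated left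
`B`-module, `(·,·)` a nondegenerate alternating skew-Hermitian form.  (The `p`-integral data `𝒪_B`,
`Λ₀`, the level `K^p` and `h` are not used in §7's rational statements.)
[cite: Kottwitz1992, §5 (p. 389)] -/
structure IsRationalDatum : Prop where
  /-- `B` is a simple ring. -/
  isSimpleRing : IsSimpleRing B
  /-- `B` is finite-dimensional over `ℚ`. -/
  finiteDimensional : FiniteDimensional ℚ B
  /-- `*` is a positive (anti-)involution of the `ℚ`-algebra `B`. -/
  positive : Literature.RingTheory.CentralSimple.IsPositiveAntiInvolution B ι
  /-- `V ≠ 0`. -/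
  nontrivial : Nontrivial V
  /-- `V` is finitely generated (equivalently finite-dimensional over `ℚ`). -/
  finiteDimensionalV : FiniteDimensional ℚ V
  /-- `(V, (·,·))` is a nondegenerate skew-Hermitian `B`-module. -/
  skewHermitian : IsSkewHermitian ℚ ι φ

variable (K : Type) [Field K] [Algebra ℚ K]
variable {BK : Type} [Ring BK] [Algebra K BK] [Algebra ℚ BK] [IsScalarTower ℚ K BK] (ιK : BK →ₗ[K] BK)
variable (jB : B →ₐ[ℚ] BK)

/-- PRESENTATION OF `B ⊗_ℚ K` with its involution: `jB : B → B_K` exhibits the `K`-algebra `B_K` as the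
base change of `B` (Mathlib `IsBaseChange`), and `ι_K` is the `K`-linear anti-involution extending `*`.
[cite: Kottwitz1992, §5 (p. 389), «`C ⊗_ℚ R`»] -/
structure IsAlgebraExtension : Prop where
  /-- `B_K = B ⊗_ℚ K` as a `K`-module, via `jB`. -/
  isBaseChange : IsBaseChange K jB.toLinearMap
  /-- `ι_K` extends `ι`. -/
  map_invol : ∀ b : B, ιK (jB b) = jB (ι b)
  /-- `ι_K` reverses products. -/
  invol_mul : ∀ x y : BK, ιK (x * y) = ιK y * ιK x
  /-- `ι_K` is an involution. -/
  invol_invol : ∀ x : BK, ιK (ιK x) = x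

variable {VK : Type} [AddCommGroup VK] [Module K VK] [Module ℚ VK] [IsScalarTower ℚ K VK]
  [Module BK VK] [IsScalarTower K BK VK] (φK : LinearMap.BilinForm K VK) (jV : V →ₗ[ℚ] VK)

/-- PRESENTATION OF `V ⊗_ℚ K` as a skew-Hermitian `B_K`-module: `jV : V → V_K` is a base change
(`IsBaseChange K jV`), `B`-equivariant along `jB`, and `φ_K` extends `(·,·)`.
[cite: Kottwitz1992, §5 (p. 389), «`V_ℝ`», «`V_{ℚ_p}`»] -/
structure IsModuleExtension : Prop where
  /-- `V_K = V ⊗_ℚ K` via `jV`. -/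
  isBaseChange : IsBaseChange K jV
  /-- `jV (b v) = jB(b) jV(v)`. -/
  map_smul : ∀ (b : B) (v : V), jV (b • v) = jB b • jV v
  /-- `φ_K (jV v) (jV w) = (v, w)`. -/
  map_form : ∀ v w : V, φK (jV v) (jV w) = algebraMap ℚ K (φ v w)

/-! ### Lemma 7.1 (p. 395) -/

/-- **[Kottwitz1992, Lemma 7.1 (p. 395)]**, verbatim (p0022 L63 – p0023 L9): «We will also need to
understand conjugacy classes in `G(K)`, where `K` is an algebraically closed field containing `ℚ`. For
this we consider the obvious embedding `i : G ↪ H`, where `H` denotes the `ℚ`-group `C^×` (recall that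
`C = End_B(V)`), as well as the homomorphism `c : G → 𝔾_m` that associates to `g ∈ G(K)` the scalar
`c(g) ∈ K^×` such that `(gv, gw) = c(v, w)` for all `v, w ∈ V`.
**Lemma 7.1.** Two elements `x, y` of `G(K)` are conjugate if and only if `c(x) = c(y)` and `i(x), i(y)`
are conjugate in `H(K)`.»

TYPED for the rational datum `(B, ι, V, φ)` of §5 (`IsRationalDatum`), `K` algebraically closed of
characteristic `0`, and a presentation `(B_K, ι_K, jB; V_K, φ_K, jV)` of the extension of scalars to `K`;
`G(K) = similitudes K φ_K ⊆ H(K) = (End_{B_K} V_K)ˣ`, «conjugate» in `G(K)` = by an element of `G(K)`,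
«conjugate in `H(K)`» = Mathlib `IsConj` in the unit group.  Proved special cases in the tree (one factor
`Sp ∕ O ∕ GL × GL`): `Literature.LinearAlgebra.Matrix.IsometryConjugacy.exists_similitude_conj_iff`
et al. (module docstring). [cite: Kottwitz1992, Lemma 7.1 (p. 395)] -/
def Kottwitz1992_7_1_conj_iff [IsAlgClosed K] [CharZero K] : Prop :=
  IsRationalDatum ι φ → IsAlgebraExtension ι K ιK jB → IsModuleExtension φ K jB φK jV →
    ∀ x y : (Module.End BK VK)ˣ, x ∈ similitudes K φK BK → y ∈ similitudes K φK BK →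
      ((∃ g ∈ similitudes K φK BK, g * x * g⁻¹ = y) ↔ (SameMultiplier K φK BK x y ∧ IsConj x y))

/-! ### Local isomorphism of skew-Hermitian modules (the dictionary for `H¹`, READING R-H1) -/

variable {V' : Type} [AddCommGroup V'] [Module ℚ V'] [Module B V'] [IsScalarTower ℚ B V']
  (φ' : LinearMap.BilinForm ℚ V')

/-- `(V, (·,·))` and `(V', (·,·)')` become isomorphic skew-Hermitian `B`-modules over the field
`K ⊇ ℚ` (isomorphism = `B_K`-linear isomorphism carrying one form to a `K^×`-multiple of the other,
p. 391: «by an isomorphism of skew-Hermitian `B`-modules we mean a `B`-module isomorphism carrying one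
alternating form into a scalar multiple of the other»): for every presentation of the base change of
`B`, `V`, `V'` to `K`, such an isomorphism exists.  With `K = ℚ_v` this says that the classes of `V` and
`V'` in `H¹(ℚ_v, G)` agree (p. 399: «Isomorphism classes of skew-Hermitian `B`-modules of the same
dimension as `V` are classified by `H¹(ℚ, G)`»; READING R-H1).
[cite: Kottwitz1992, §5 (p. 391) and §8 (p. 399)] -/
def LocallyIsomorphic : Prop :=
  ∀ (BK : Type) [Ring BK] [Algebra K BK] [Algebra ℚ BK] [IsScalarTower ℚ K BK] (ιK : BK →ₗ[K] BK)
    (jB : B →ₐ[ℚ] BK)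
    (VK : Type) [AddCommGroup VK] [Module K VK] [Module ℚ VK] [IsScalarTower ℚ K VK] [Module BK VK]
    [IsScalarTower K BK VK] (φK : LinearMap.BilinForm K VK) (jV : V →ₗ[ℚ] VK)
    (VK' : Type) [AddCommGroup VK'] [Module K VK'] [Module ℚ VK'] [IsScalarTower ℚ K VK'] [Module BK VK']
    [IsScalarTower K BK VK'] (φK' : LinearMap.BilinForm K VK') (jV' : V' →ₗ[ℚ] VK'),
    IsAlgebraExtension ι K ιK jB → IsModuleExtension φ K jB φK jV → IsModuleExtension φ' K jB φK' jV' →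
      ∃ (e : VK ≃ₗ[BK] VK') (c : Kˣ), ∀ v w : VK, φK' (e v) (e w) = (c : K) * φK v w

/-- `(V, (·,·))` and `(V', (·,·)')` are isomorphic skew-Hermitian `B`-modules over `ℚ` (form carried to a
`ℚ^×`-multiple). [cite: Kottwitz1992, §5 (p. 391)] -/
def Isomorphic (B : Type) [Ring B] [Module B V] [Module B V'] : Prop :=
  ∃ (e : V ≃ₗ[B] V') (c : ℚˣ), ∀ v w : V, φ' (e v) (e w) = (c : ℚ) * φ v w

/-- The integer `n` of Case A: «we write `n` for the dimension of the Hermitian vector space giving rise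
to this unitary group» (p. 393); from p. 390, `m = [F : F₀](dim_F C)^{1/2} = 2n` with `[F : F₀] = 2`, so
`n² = dim_F C`, i.e. `[F : ℚ] · n² = dim_ℚ End_B(V)`. [cite: Kottwitz1992, §7 (p. 393) with §5 (p. 390)] -/
def IsUnitaryRank (n : ℕ) : Prop :=
  finrank ℚ (Subalgebra.center ℚ B) * n ^ 2 = finrank ℚ (Module.End B V)

/-! ### The Hasse principle for `H¹(ℚ, G)` (pp. 393–394) -/

/-- **[Kottwitz1992, §7 pp. 393–394] Hasse principle, Case C and Case A with `n` even**, verbatim: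
«Later we will need information about the Hasse principle for `H¹(ℚ, G)`. We write `ker¹(ℚ, G)` for the
locally trivial elements in `H¹(ℚ, G)`. In Case D the Hasse principle fails. In Cases A and C, we write
`D` for the torus obtained as the quotient of `G` by its derived group and use the fact that
`ker¹(ℚ, G) = ker¹(ℚ, D)` (see Lemma 4.3.1 of [K2]). In Case C the torus `D` is isomorphic to `𝔾_m`, and
therefore `G` satisfies the Hasse principle. […] Since the tori `D₁` and `𝔾_m` both satisfy the Hasse
principle, the group `G` satisfies the Hasse principle in Case A if `n` is even.» (p0021 L34–L43,
p0022 L5–L10).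

TYPED (READING R-H1, `ker¹(ℚ, G)` trivial): in Case C, or in Case A with `n` even, every nondegenerate
skew-Hermitian `B`-module `V'` that is `B`-isomorphic to `V` and isomorphic to `V` as a skew-Hermitian
module over `ℝ` and over every `ℚ_ℓ` is isomorphic to `V` over `ℚ`.  The torus isomorphisms
`D ≅ D₁ × 𝔾_m` (`n = 2k`) and `D ≅ {x : N x ∈ 𝔾_m}` (`n = 2k+1`) are PROVED in the tree
(`Literature.NumberTheory.Automorphic.UnitarySimilitude.exists_mulEquiv_prod`,
`….exists_mulEquiv_of_injective`) and are not restated. [cite: Kottwitz1992, §7 (pp. 393–394)] -/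
def Kottwitz1992_7_hassePrinciple : Prop :=
  IsRationalDatum ι φ → (IsCaseC ℚ ι φ ∨ (IsCaseA ℚ ι ∧ ∃ n : ℕ, IsUnitaryRank (B := B) (V := V) n ∧ Even n)) →
    ∀ (V' : Type) [AddCommGroup V'] [Module ℚ V'] [Module B V'] [IsScalarTower ℚ B V']
      (φ' : LinearMap.BilinForm ℚ V'),
      IsSkewHermitian ℚ ι φ' → Nonempty (V ≃ₗ[B] V') →
      LocallyIsomorphic ι φ ℝ φ' → (∀ (ℓ : ℕ) [Fact ℓ.Prime], LocallyIsomorphic ι φ ℚ_[ℓ] φ') →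
        Isomorphic φ φ' B

/-- An element `a ∈ F₀^×` (central in `B`, `*`-fixed, invertible) represents the TRIVIAL class of
`H¹(K, Z)`, `Z` the centre of `G`, over the field `K ⊇ ℚ`: by «`H¹(ℚ, Z) = F₀^×/ℚ^× N_{F/F₀}(F^×)`»
(p. 400, applied over `K`), `a = q · x x*` for some `q ∈ K^×` and some unit `x` of the centre
`F ⊗ K` of `B_K` — for every presentation of `B_K` (READING R-Z).
[cite: Kottwitz1992, §8 (p. 400) with §7 (p. 394)] -/
def CentralClassTrivialOver (a : B) : Prop :=
  ∀ (BK : Type) [Ring BK] [Algebra K BK] [Algebra ℚ BK] [IsScalarTower ℚ K BK] (ιK : BK →ₗ[K] BK)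
    (jB : B →ₐ[ℚ] BK), IsAlgebraExtension ι K ιK jB →
      ∃ (q : Kˣ) (x : BK), x ∈ Subalgebra.center K BK ∧ IsUnit x ∧ jB a = (q : K) • (x * ιK x)

/-- The form twisted by a central `*`-symmetric `a`: `(v, w)_a := (a v, w)` (the Riemann form of the
polarization `λ ∘ i(a)` of p. 400). [cite: Kottwitz1992, §8 (p. 400)] -/
def twistForm (a : B) : LinearMap.BilinForm ℚ V :=
  φ.compLeft (DistribSMul.toLinearMap ℚ V a)

/-- **[Kottwitz1992, §7 p. 394] Case A, `n` odd: `ker¹(ℚ, Z) → ker¹(ℚ, G)` is a bijection**, verbatim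
(p0022 L15–L18): «We now concentrate on Case A with `n` odd and show that the failure of the Hasse
principle is of a harmless nature, in that it comes from the failure of the Hasse principle for the center
`Z` of `G`. In fact we will show that the canonical map `ker¹(ℚ, Z) → ker¹(ℚ, G)` is a bijection.»
(proof p0022 L18–L62: `H¹(ℚ_v, D₁) = F₀ᵥ^×/N(F_v^×)` is killed by `2`; `ker²(ℚ, Z₀)` is trivial by
Tate–Nakayama and Shapiro).

TYPED through READINGS R-H1 and R-Z (`F₀^× ∋ a ↦` the class of `(V, (a·,·))`): SURJECTIVE — every
nondegenerate skew-Hermitian `V' ≃_B V` locally isomorphic to `V` everywhere is isomorphic over `ℚ` to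
`(V, (a·,·))` for some central `*`-fixed unit `a` whose class in `H¹(ℚ_v, Z)` is trivial for all `v`;
INJECTIVE — if two such `a, a'` give isomorphic twisted modules then `a' ∈ ℚ^× N_{F/F₀}(F^×) a`.
[cite: Kottwitz1992, §7 (p. 394)] -/
def Kottwitz1992_7_kerOne_center_bijective : Prop :=
  IsRationalDatum ι φ → IsCaseA ℚ ι → (∃ n : ℕ, IsUnitaryRank (B := B) (V := V) n ∧ Odd n) →
    (∀ (V' : Type) [AddCommGroup V'] [Module ℚ V'] [Module B V'] [IsScalarTower ℚ B V']
        (φ' : LinearMap.BilinForm ℚ V'),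
        IsSkewHermitian ℚ ι φ' → Nonempty (V ≃ₗ[B] V') →
        LocallyIsomorphic ι φ ℝ φ' → (∀ (ℓ : ℕ) [Fact ℓ.Prime], LocallyIsomorphic ι φ ℚ_[ℓ] φ') →
          ∃ a : B, a ∈ Subalgebra.center ℚ B ∧ ι a = a ∧ IsUnit a ∧
            CentralClassTrivialOver ι ℝ a ∧ (∀ (ℓ : ℕ) [Fact ℓ.Prime], CentralClassTrivialOver ι ℚ_[ℓ] a) ∧
            Isomorphic (twistForm φ a) φ' B) ∧
    (∀ a a' : B, a ∈ Subalgebra.center ℚ B → ι a = a → IsUnit a →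
        a' ∈ Subalgebra.center ℚ B → ι a' = a' → IsUnit a' →
        CentralClassTrivialOver ι ℝ a → (∀ (ℓ : ℕ) [Fact ℓ.Prime], CentralClassTrivialOver ι ℚ_[ℓ] a) →
        CentralClassTrivialOver ι ℝ a' → (∀ (ℓ : ℕ) [Fact ℓ.Prime], CentralClassTrivialOver ι ℚ_[ℓ] a') →
        Isomorphic (twistForm φ a) (twistForm φ a') B →
          ∃ (q : ℚˣ) (x : B), x ∈ Subalgebra.center ℚ B ∧ IsUnit x ∧ a' = (q : ℚ) • (x * ι x) * a)

end Rational

/-! ## 3. The `p`-adic statements: Lemma 7.2, Corollary 7.3, Lemma 7.4 (with Remark 7.5 built in) -/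

section Padic

variable (p : ℕ) [Fact p.Prime]

/-- The coefficient ring of Lemmas 7.2–7.4 as extended by Remark 7.5: `O` is the valuation ring of
`ℚ_p` or of a finite unramified extension of `ℚ_p` — a `p`-adically complete discrete valuation ring of
characteristic `0` whose residue field is finite of characteristic `p` and in which `p` is a
uniformizer (`e = 1`).  `O = ℤ_[p]` qualifies. [cite: Kottwitz1992, Remark 7.5 (p. 398)] -/
structure IsUnramifiedLocalRing (O : Type) [CommRing O] [IsDomain O] : Prop where
  /-- discrete valuation ring -/
  isDVR : IsDiscreteValuationRing O
  /-- characteristic zero -/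
  charZero : CharZero O
  /-- complete for the maximal ideal -/
  complete : IsAdicComplete (IsLocalRing.maximalIdeal O) O
  /-- finite residue field … -/
  finiteResidueField : Finite (IsLocalRing.ResidueField O)
  /-- … of characteristic `p` -/
  charResidueField : CharP (IsLocalRing.ResidueField O) p
  /-- `p` is a uniformizer (the extension of `ℚ_p` is unramified) -/
  uniformizer : IsLocalRing.maximalIdeal O = Ideal.span {(p : O)}

variable {O L : Type} [CommRing O] [IsDomain O] [Field L] [Algebra O L] [IsFractionRing O L]
variable {BL : Type} [Ring BL] [Algebra L BL] [Algebra O BL] [IsScalarTower O L BL] (ιL : BL →ₗ[L] BL)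
variable (OB : Subalgebra O BL)
variable {VL : Type} [AddCommGroup VL] [Module L VL] [Module O VL] [IsScalarTower O L VL]
  [Module BL VL] [IsScalarTower L BL VL] (φL : LinearMap.BilinForm L VL)

/-- «`F` is a finite product of finite unramified extensions of `ℚ_p`, the algebra `B` is a matrix
algebra over `F`» (p. 395; from §5 p. 389: «`B_{ℚ_p}` is a product of matrix algebras over unramified
extensions of `ℚ_p`»), over the coefficient field `L`: an `L`-algebra isomorphism
`B_L ≃ ∏ᵢ M_d(Fᵢ)` with each `Fᵢ` a finite extension of `L` generated by a root of unity of order prime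
to `p` (i.e. unramified over `L`).  ⟨INTERFACE⟩ datum; only its existence (`Nonempty`) is used.
[cite: Kottwitz1992, §5 (p. 389) and §7 (p. 395)] -/
structure UnramifiedMatrixDecomposition (L BL : Type) [Field L] [Ring BL] [Algebra L BL] where
  /-- index set of the simple factors of `F_L` -/
  idx : Type
  [fintype : Fintype idx]
  /-- the fields `Fᵢ` -/
  F : idx → Type
  [field : ∀ i, Field (F i)]
  [algebra : ∀ i, Algebra L (F i)]
  /-- `Fᵢ / L` is finite … -/
  finite : ∀ i, FiniteDimensional L (F i)
  /-- … and unramified: `Fᵢ = L(ζ)` with `ζ` a root of unity of order prime to `p` -/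
  unramified : ∀ i, ∃ m : ℕ, ¬ p ∣ m ∧ ∃ ζ : F i, IsPrimitiveRoot ζ m ∧ Algebra.adjoin L {ζ} = ⊤
  /-- the common matrix size `d` (`d² = dim_F B`) -/
  d : ℕ
  /-- `B_L ≃ ∏ᵢ M_d(Fᵢ)` as `L`-algebras -/
  equiv : BL ≃ₐ[L] ((i : idx) → Matrix (Fin d) (Fin d) (F i))

/-- «by `𝒪_B`-lattice in `V` we mean a lattice that is an `𝒪_B`-submodule» (p. 395): `Λ` is a finitely
generated `O`-submodule spanning `V_L` (Mathlib `Submodule.IsLattice`) and stable under `𝒪_B`.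
[cite: Kottwitz1992, §7 (p. 395)] -/
def IsOBLattice (L : Type) [Field L] [Algebra O L] [Module L VL] [IsScalarTower O L VL]
    {BL : Type} [Ring BL] [Algebra O BL] [Module BL VL] (OB : Subalgebra O BL) (Λ : Submodule O VL) : Prop :=
  Submodule.IsLattice L Λ ∧ ∀ b ∈ OB, ∀ v ∈ Λ, b • v ∈ Λ

/-- `Λ` is self-dual for `φ_L`: `Λ = {v | (v, Λ) ⊆ O}` (Mathlib `LinearMap.BilinForm.dualSubmodule`).
[cite: Kottwitz1992, §5 (p. 389) «self-dual for `(·,·)`» and §7 (p. 395)] -/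
def IsSelfDual (Λ : Submodule O VL) : Prop :=
  φL.dualSubmodule Λ = Λ

/-- `Λ` is «self-dual up to a scalar in `ℚ_p^×`» (Cor. 7.3, p. 396): self-dual for `c (·,·)`, some
`c ∈ L^×`. [cite: Kottwitz1992, Corollary 7.3 (p. 396)] -/
def IsSelfDualUpToScalar (Λ : Submodule O VL) : Prop :=
  ∃ c : Lˣ, ((c : L) • φL).dualSubmodule Λ = Λ

/-- The standing `p`-adic hypotheses of §7 (p. 395, p0023 L22–L32), for the `p`-adic datum
`(B_L, ι_L, 𝒪_B, V_L, φ_L)` over `(O, L)`: «Because of the conditions imposed in §5 the `ℚ_p`-algebra `F`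
is a finite product of finite unramified extensions of `ℚ_p`, the algebra `B` is a matrix algebra over
`F`, the order `𝒪_B` is a maximal order in `B` (hence is a matrix algebra over `𝒪_F`), the involution `*`
of `B` preserves `𝒪_B`, and there exists a self-dual `𝒪_B`-lattice `Λ` in `V`», together with the
skew-Hermitian structure carried over from §5.  Here `𝒪_B` denotes the `p`-adic completion of the
`ℤ_(p)`-order of §5. [cite: Kottwitz1992, §7 (p. 395)] -/
structure IsPadicDatum : Prop where
  /-- the coefficients: `ℚ_p` or a finite unramified extension (Remark 7.5) -/
  coefficients : IsUnramifiedLocalRing p O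
  /-- `ι_L` reverses products -/
  invol_mul : ∀ x y : BL, ιL (x * y) = ιL y * ιL x
  /-- `ι_L` is an involution -/
  invol_invol : ∀ x : BL, ιL (ιL x) = x
  /-- `B_L ≃ ∏ M_d(Fᵢ)`, `Fᵢ` unramified -/
  split : Nonempty (UnramifiedMatrixDecomposition p L BL)
  /-- `𝒪_B` is an `O`-order of `B_L` (an `O`-lattice that is a subring) … -/
  order_isLattice : Submodule.IsLattice L (Subalgebra.toSubmodule OB)
  /-- … and a maximal one -/
  order_maximal : ∀ O' : Subalgebra O BL, Submodule.IsLattice L (Subalgebra.toSubmodule O') →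
    OB ≤ O' → O' = OB
  /-- `*` preserves `𝒪_B` -/
  order_invol : ∀ b ∈ OB, ιL b ∈ OB
  /-- `V_L` is finite-dimensional -/
  finiteDimensional : FiniteDimensional L VL
  /-- `(V_L, φ_L)` is nondegenerate skew-Hermitian -/
  skewHermitian : IsSkewHermitian L ιL φL
  /-- there exists a self-dual `𝒪_B`-lattice in `V_L` -/
  exists_selfDual : ∃ Λ : Submodule O VL, IsOBLattice L OB Λ ∧ IsSelfDual φL Λ

/-- The stabilizer of the lattice `Λ` in `H(L) = C_L^× = (End_{B_L} V_L)ˣ` (Lemma 7.4's `K_H`).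
[cite: Kottwitz1992, §7 (p. 397)] -/
def latticeStabilizer (BL : Type) [Ring BL] [Module BL VL] (Λ : Submodule O VL) :
    Set (Module.End BL VL)ˣ :=
  {h | ∀ v : VL, v ∈ Λ ↔ (h : Module.End BL VL) v ∈ Λ}

/-- **[Kottwitz1992, Lemma 7.2 (p. 395)]**, verbatim (p0023 L34–L47): «**Lemma 7.2.** Let `(V', (·,·)')`
be a nondegenerate skew-Hermitian `B`-module such that `V'` is isomorphic to `V` as `B`-module. Suppose
that `Λ'` is a self-dual `𝒪_B`-lattice in `V'`. In Case D assume further that `p ≠ 2` and that under the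
map `H¹(ℚ_p, G) → H¹(ℚ_p, G/G⁰)`, the element of `H¹(ℚ_p, G)` that measures the difference between `V` and
`V'` is sent to the trivial element of `H¹(ℚ_p, G/G⁰)`. Then there exists an isomorphism `φ : V → V'` of
skew-Hermitian `B`-modules such that `φ(Λ) = Λ'`.»  (Here `V, B, 𝒪_B` are the `p`-adic objects of
p. 395 and `Λ` is the self-dual `𝒪_B`-lattice fixed there; by Remark 7.5 (p. 398) `ℚ_p` may be any
finite unramified extension `L`.)

TYPED in **Cases A and C** (the Case-D side condition on `H¹(ℚ_p, G/G⁰)` is not typed — module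
docstring): for a `p`-adic datum (`IsPadicDatum`), a self-dual `𝒪_B`-lattice `Λ ⊆ V_L`, and any
nondegenerate skew-Hermitian `B_L`-module `(V', φ')` with `V' ≃_{B_L} V_L` carrying a self-dual
`𝒪_B`-lattice `Λ'`, there is a `B_L`-linear isomorphism `ψ : V_L → V'` carrying `φ_L` to an
`L^×`-multiple of `φ'` (p. 391: isomorphisms preserve the form up to a scalar) with `ψ(Λ) = Λ'`.
Split one-factor cases are PROVED in the tree (`Literature.LinearAlgebra.Matrix.HermitianFormsHensel…`,
module docstring). [cite: Kottwitz1992, Lemma 7.2 (p. 395) and Remark 7.5 (p. 398)] -/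
def Kottwitz1992_7_2_exists_iso_map_lattice (Λ : Submodule O VL) : Prop :=
  IsPadicDatum p ιL OB φL → (IsCaseA L ιL ∨ IsCaseC L ιL φL) → IsOBLattice L OB Λ → IsSelfDual φL Λ →
    ∀ (V' : Type) [AddCommGroup V'] [Module L V'] [Module O V'] [IsScalarTower O L V'] [Module BL V']
      [IsScalarTower L BL V'] (φ' : LinearMap.BilinForm L V') (Λ' : Submodule O V'),
      IsSkewHermitian L ιL φ' → Nonempty (VL ≃ₗ[BL] V') → IsOBLattice L OB Λ' → IsSelfDual φ' Λ' →
        ∃ (ψ : VL ≃ₗ[BL] V') (c : Lˣ), (∀ v w : VL, φ' (ψ v) (ψ w) = (c : L) * φL v w) ∧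
          (∀ v : VL, v ∈ Λ → ψ v ∈ Λ') ∧ (∀ v' : V', v' ∈ Λ' → ψ.symm v' ∈ Λ)

/-- **[Kottwitz1992, Corollary 7.3 (p. 396)]**, verbatim (p0024 L45–L48): «**Corollary 7.3.** In Case D
assume that `p ≠ 2`. Then `G(ℚ_p)` acts transitively on the set of `𝒪_B`-lattices `Λ'` in `V` that are
self-dual up to a scalar in `ℚ_p^×`.  Apply Lemma 7.2 to `(V, (·,·), Λ)` and `(V, c(·,·), Λ')`, where
`c ∈ ℚ_p^×` is chosen so that `Λ'` is self-dual with respect to `c(·,·)`.»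

TYPED (all three cases, `p ≠ 2` assumed in Case D; `ℚ_p` or an unramified `L`, Remark 7.5): any two
`𝒪_B`-lattices in `V_L` that are self-dual up to a scalar are carried onto each other by an element of
`G(L) = similitudes L φ_L`.  One-factor split cases PROVED in the tree:
`Literature.NumberTheory.QuadraticForms.SelfDualUpToScalar.exists_similitude_map_eq_padic` et al.
[cite: Kottwitz1992, Corollary 7.3 (p. 396) and Remark 7.5 (p. 398)] -/
def Kottwitz1992_7_3_transitive_selfDualUpToScalar : Prop :=
  IsPadicDatum p ιL OB φL → (IsCaseD L ιL φL → p ≠ 2) →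
    ∀ Λ₁ Λ₂ : Submodule O VL, IsOBLattice L OB Λ₁ → IsSelfDualUpToScalar φL Λ₁ →
      IsOBLattice L OB Λ₂ → IsSelfDualUpToScalar φL Λ₂ →
        ∃ g ∈ similitudes L φL BL, ∀ v : VL, v ∈ Λ₁ ↔ (g : Module.End BL VL) v ∈ Λ₂

/-- **[Kottwitz1992, Lemma 7.4 (p. 397)]**, verbatim (p0024 L49 – p0025 L8): «We continue to work with
`p`-adic objects `F, F₀, B, V, C`, and we again consider the embedding `i : G ↪ H := C^×`. Let `Λ` be a
self-dual `𝒪_B`-lattice in `V` and let `K` (respectively, `K_H`) denote its stabilizer in `G(ℚ_p)`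
(respectively, `H(ℚ_p)`).  **Lemma 7.4.** Let `x, y ∈ G(ℚ_p)`, and assume that `K_H i(x) K_H = K_H i(y) K_H`.
Then `K x K = K y K`.»

TYPED (`ℚ_p` or an unramified `L`, Remark 7.5): with `H(L) = (End_{B_L} V_L)ˣ`, `K_H` = the stabilizer
of `Λ`, `K = K_H ∩ G(L)`: if `y ∈ K_H x K_H` then `y ∈ K x K`.  Case C for `GSp_{2n}(ℚ_p)` is PROVED
in the tree (`Literature.NumberTheory.Automorphic.SymplecticCartan.eq_of_similitudeTorusElt_mem_doubleCoset`,
file `SymplecticSimilitudeDoubleCosets`, et al., module docstring).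
[cite: Kottwitz1992, Lemma 7.4 (p. 397) and Remark 7.5 (p. 398)] -/
def Kottwitz1992_7_4_doubleCoset (Λ : Submodule O VL) : Prop :=
  IsPadicDatum p ιL OB φL → IsOBLattice L OB Λ → IsSelfDual φL Λ →
    ∀ x y : (Module.End BL VL)ˣ, x ∈ similitudes L φL BL → y ∈ similitudes L φL BL →
      (∃ a ∈ latticeStabilizer BL Λ, ∃ b ∈ latticeStabilizer BL Λ, a * x * b = y) →
        ∃ a ∈ latticeStabilizer BL Λ ∩ similitudes L φL BL, ∃ b ∈ latticeStabilizer BL Λ ∩ similitudes L φL BL,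
          a * x * b = y

end Padic

/-! ## 4. ED. 2 (TK-t03 g2, DEAL v5): Lemma 7.2 in Case D — the proof-reduced form (pp. 395–396)

ED. 1 (p847772) typed Lemma 7.2 in Cases A and C only and left `-- TODO(Case D of Lemma 7.2)`: the
printed Case-D hypothesis — «assume further that `p ≠ 2` and that under the map
`H¹(ℚ_p, G) → H¹(ℚ_p, G/G⁰)`, the element of `H¹(ℚ_p, G)` that measures the difference between `V` and
`V'` is sent to the trivial element of `H¹(ℚ_p, G/G⁰)`» (p. 395, p0023 L35–L46) — has no Lean
vocabulary (Mathlib has neither `H¹(ℚ_p, G)` of a linear algebraic group nor the component group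
`G/G⁰`).  The PROOF (p. 395 L49 – p. 396 L44) uses that hypothesis at exactly one place.  The lemma is
first proved, in all three cases, under a residual assumption: «Assume for the moment that the
skew-Hermitian `𝒪_B/p𝒪_B`-modules `Λ/pΛ` and `Λ'/pΛ'` are isomorphic; later in the proof we will see
that this assumption holds automatically» (p. 395 L49–L51) … «Continuing this process for `p³, p⁴, …`,
we eventually get `ψ ∈ C₀` such that `id_Λ + pψ` is an isomorphism of skew-Hermitian `𝒪_B`-modules from
`(V, (·,·))` to `(V, (·,·)')`. This proves the lemma under the assumption made at the beginning of the
proof» (p. 396 L29–L31), the lifting step `ψ + ψ* ≡ (β - 1)/p (mod p)` being solvable «If `p ≠ 2`»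
(any case), «If `p = 2` and we are in Case A», «If `p = 2` and we are in Case C» (p. 396 L22–L28).  Then:
«In Cases A and C Lang's theorem implies that any two nondegenerate skew-Hermitian forms on `Λ/pΛ` are
equivalent, and therefore the assumption we made holds automatically. In Case D we are dealing with a
disconnected group, and we are not yet in a position to use Lang's theorem. However, … the additional
hypothesis we made in Case D implies that the difference between the skew-Hermitian `𝒪_B/p𝒪_B`-modules
`Λ/pΛ` and `Λ'/pΛ'` comes from an element of `H¹(𝔽_p, G⁰(𝔽̄_p))`, and this cohomology set is trivial
by Lang's theorem. Therefore `Λ/pΛ` and `Λ'/pΛ'` are indeed isomorphic, and the proof of the lemma is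
complete» (p. 396 L31–L44).

So Lemma 7.2 in Case D is TYPED IN ITS PROOF-REDUCED FORM: the cohomological hypothesis is replaced by
the residual isomorphism `Λ/pΛ ≅ Λ'/pΛ'` of skew-Hermitian `𝒪_B/p𝒪_B`-modules that the paper derives
from it (READING R-D, flagged for the citation desk together with R-H1∕R-Z above).  Given the other
hypotheses the printed lemma IMPLIES the typed statement and not conversely:
[printed `H¹(ℚ_p, G/G⁰)` condition] ⇒ [`Λ/pΛ ≅ Λ'/pΛ'`] (p. 396 L33–L44) ⇒ [conclusion] (p. 395 L49 –
p. 396 L31); the typed fact asserts only the second arrow, which the text proves in every printed regime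
of the lifting step (`p ≠ 2`, or Case A, or Case C), so it is never stronger than the source.  In Cases
A and C the residual hypothesis «holds automatically» and the unconditional statement is
`Kottwitz1992_7_2_exists_iso_map_lattice` above (this block adds nothing there); in Case D (`p ≠ 2`) the
fact below is the typed Lemma 7.2.  Proved special case in the tree (one split factor `B = ℚ_p`,
unimodular `ε`-symmetric matrices over `ℤ_p`, `p ≠ 2`, the same two-stage Newton iteration «transport
modulo `p` ⇒ `GL_n(ℤ_p)`-equivalent»): `Literature.LinearAlgebra.Matrix.HermitianFormsHensel.
exists_isometry_padicInt_of_conj_dvd` (and `exists_isometry_padicInt`, file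
`LinearAlgebra/Matrix/HermitianFormsHenselLemma`) — cited, not restated; the general `B_L`-module
statement below is not in the tree.  ED. 1 is byte-identical above this block. -/

section PadicResidual

variable (p : ℕ) [Fact p.Prime]
variable {O L : Type} [CommRing O] [IsDomain O] [Field L] [Algebra O L] [IsFractionRing O L]
variable {BL : Type} [Ring BL] [Algebra L BL] [Algebra O BL] [IsScalarTower O L BL] (ιL : BL →ₗ[L] BL)
variable (OB : Subalgebra O BL)
variable {VL : Type} [AddCommGroup VL] [Module L VL] [Module O VL] [IsScalarTower O L VL]
  [Module BL VL] [IsScalarTower L BL VL] (φL : LinearMap.BilinForm L VL)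

/-- «the skew-Hermitian `𝒪_B/p𝒪_B`-modules `Λ/pΛ` and `Λ'/pΛ'` are isomorphic» (p. 395 L49–L50, the
standing assumption of the first part of the proof of Lemma 7.2), for `𝒪_B`-lattices `Λ ⊆ V_L`,
`Λ' ⊆ V'` on which `φ_L`, `φ'` are `O`-valued (they are self-dual in the lemma), UNFOLDED on
representatives so that no quotient structure has to be built: there are an `O`-linear isomorphism
`ψ̄ : Λ/pΛ ≃ Λ'/pΛ'` (`pΛ = (p)·Λ`, Mathlib `Ideal.span {p} • ⊤` and `Submodule.Quotient`) and a unit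
`u ∈ O^×` such that (i) `ψ̄` commutes with `𝒪_B` — if `ψ̄ [v] = [v']` then `ψ̄ [b v] = [b v']` for
`b ∈ 𝒪_B` — i.e. `ψ̄` is `𝒪_B/p𝒪_B`-linear, and (ii) `ψ̄` carries the reduction of `φ'` modulo `p` to
`ū` times the reduction of `φ_L`: `φ'(v', w') - u·φ_L(v, w) ∈ pO` whenever `ψ̄ [v] = [v']`,
`ψ̄ [w] = [w']` (an isomorphism of skew-Hermitian modules carries one form «into a scalar multiple of
the other», p. 391; here the scalar is a unit of `𝒪_B/p𝒪_B ⊇ O/pO` — «Modifying the alternating form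
`(·,·)'` by a unit, we may assume that `ψ̄` carries the alternating form on `Λ'/pΛ'` into the alternating
form on `Λ/pΛ` (not just a scalar multiple of that form)», p. 395 L51–L52).
[cite: Kottwitz1992, Lemma 7.2, proof (p. 395)] -/
def ResiduallyIsomorphic {V' : Type} [AddCommGroup V'] [Module L V'] [Module O V'] [Module BL V']
    (φ' : LinearMap.BilinForm L V') (Λ : Submodule O VL) (Λ' : Submodule O V') : Prop :=
  ∃ (ψ : (↥Λ ⧸ (Ideal.span {(p : O)} • ⊤ : Submodule O Λ)) ≃ₗ[O]
      (↥Λ' ⧸ (Ideal.span {(p : O)} • ⊤ : Submodule O Λ'))) (u : Oˣ),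
    (∀ b ∈ OB, ∀ (v bv : Λ) (v' bv' : Λ'), (bv : VL) = b • (v : VL) → (bv' : V') = b • (v' : V') →
      ψ (Submodule.Quotient.mk v) = Submodule.Quotient.mk v' →
        ψ (Submodule.Quotient.mk bv) = Submodule.Quotient.mk bv') ∧
    (∀ (v w : Λ) (v' w' : Λ'), ψ (Submodule.Quotient.mk v) = Submodule.Quotient.mk v' →
      ψ (Submodule.Quotient.mk w) = Submodule.Quotient.mk w' →
        ∃ t : O, φ' (v' : V') (w' : V') - algebraMap O L (u : O) * φL (v : VL) (w : VL) =
          algebraMap O L ((p : O) * t))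

/-- **[Kottwitz1992, Lemma 7.2 (p. 395)] in Case D, proof-reduced form (pp. 395–396).**  Verbatim
(p0023 L34–L47): «**Lemma 7.2.** Let `(V', (·,·)')` be a nondegenerate skew-Hermitian `B`-module such
that `V'` is isomorphic to `V` as `B`-module. Suppose that `Λ'` is a self-dual `𝒪_B`-lattice in `V'`. In
Case D assume further that `p ≠ 2` and that under the map `H¹(ℚ_p, G) → H¹(ℚ_p, G/G⁰)`, the element of
`H¹(ℚ_p, G)` that measures the difference between `V` and `V'` is sent to the trivial element of
`H¹(ℚ_p, G/G⁰)`. Then there exists an isomorphism `φ : V → V'` of skew-Hermitian `B`-modules such that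
`φ(Λ) = Λ'`.»  What the proof establishes, verbatim (p0024 L29–L31): «we eventually get `ψ ∈ C₀` such
that `id_Λ + pψ` is an isomorphism of skew-Hermitian `𝒪_B`-modules from `(V, (·,·))` to `(V, (·,·)')`.
This proves the lemma under the assumption made at the beginning of the proof» — the assumption being
«the skew-Hermitian `𝒪_B/p𝒪_B`-modules `Λ/pΛ` and `Λ'/pΛ'` are isomorphic» (`ResiduallyIsomorphic`),
and the lifting step being carried out for «`p ≠ 2`», for «`p = 2` and … Case A» and for «`p = 2` and …
Case C» (p0024 L22–L28); in Case D the printed cohomological hypothesis is what yields the assumption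
(p0024 L33–L44, Lang's theorem for `G⁰` over `𝔽_p`).

TYPED: for a `p`-adic datum (`IsPadicDatum`; `ℚ_p` or a finite unramified `L`, Remark 7.5 p. 398)
with `p ≠ 2 ∨ Case A ∨ Case C`, a self-dual `𝒪_B`-lattice `Λ ⊆ V_L`, and a nondegenerate
skew-Hermitian `B_L`-module `(V', φ')` with `V' ≃_{B_L} V_L` carrying a self-dual `𝒪_B`-lattice `Λ'`
such that `Λ/pΛ ≅ Λ'/pΛ'` as skew-Hermitian `𝒪_B/p𝒪_B`-modules, there is a `B_L`-linear isomorphism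
`ψ : V_L → V'` carrying `φ_L` to an `L^×`-multiple of `φ'` with `ψ(Λ) = Λ'`.  In Case D (`p ≠ 2`) this
IS the typed Lemma 7.2, its `H¹(ℚ_p, G/G⁰)` hypothesis replaced by the residual isomorphism the paper
derives from it (READING R-D; implied by the printed lemma, never stronger); in Cases A and C see
`Kottwitz1992_7_2_exists_iso_map_lattice`.
[cite: Kottwitz1992, Lemma 7.2 (p. 395), its proof (p. 396), and Remark 7.5 (p. 398)] -/
def Kottwitz1992_7_2_exists_iso_of_residuallyIsomorphic (Λ : Submodule O VL) : Prop :=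
  IsPadicDatum p ιL OB φL → (p ≠ 2 ∨ IsCaseA L ιL ∨ IsCaseC L ιL φL) →
    IsOBLattice L OB Λ → IsSelfDual φL Λ →
    ∀ (V' : Type) [AddCommGroup V'] [Module L V'] [Module O V'] [IsScalarTower O L V'] [Module BL V']
      [IsScalarTower L BL V'] (φ' : LinearMap.BilinForm L V') (Λ' : Submodule O V'),
      IsSkewHermitian L ιL φ' → Nonempty (VL ≃ₗ[BL] V') → IsOBLattice L OB Λ' → IsSelfDual φ' Λ' →
      ResiduallyIsomorphic p OB φL φ' Λ Λ' →
        ∃ (ψ : VL ≃ₗ[BL] V') (c : Lˣ), (∀ v w : VL, φ' (ψ v) (ψ w) = (c : L) * φL v w) ∧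
          (∀ v : VL, v ∈ Λ → ψ v ∈ Λ') ∧ (∀ v' : V', v' ∈ Λ' → ψ.symm v' ∈ Λ)

end PadicResidual

end Literature.NumberTheory.Kottwitz1992.GroupStructure
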